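import Mathlib
import HarnessLib
import Summits.QuantumAdvantage.QuantumAdvantage.Theorems.SoloInformedGrothendieckDeletion

/-!
# The Grothendieck deletion also shrinks the Frobenius norm

Solo seat `solo-QuantumAdvantage-informed`, session 12, file 30 (§4.27 (1)–(2) of the seat's paper).

File 29 (`SoloInformedGrothendieckDeletion`) showed: if a real matrix `A` admits a factorization bound
`|xᵀAy| ≤ K (∑ wᵢxᵢ²)^{1/2} (∑ wᵢyᵢ²)^{1/2}` with a sub-probability weight `w` (Grothendieck's inequality in
factorization form supplies one with `K = K_G‖A‖_{∞→1}`; Pisier, arXiv:1101.4195, Thm 2.1; Tropp,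
arXiv:0806.4404, Thm 12), then deleting `F := {i : wᵢ > τ}` (`|F|τ ≤ 1`) leaves every block of the remaining
matrix with operator norm `≤ Kτ`. This file adds the second half of PHASE I of the paper's THEOREM E″:
the SAME deletion makes the Frobenius norm small, so that at degree 2 no influence / hypercontractivity
argument (DFKO) is needed at all.

* `row_energy_of_factorization`: for every row `i`, `∑_{j : w_j ≤ τ} A_{ij}² ≤ K² τ wᵢ` (test the factorization
  on `x = eᵢ`, `y =` the truncated row, then cancel one factor `(∑ A_{ij}²)^{1/2}`).
* `frobenius_of_factorization`: `∑_{i,j : wᵢ, w_j ≤ τ} A_{ij}² ≤ K² τ` (sum the row bounds, `∑ wᵢ ≤ 1`).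
* `grothendieck_phase`: the `o`-form used by THEOREM E″ — for `K, o > 0` one set `F` with `|F| ≤ K/o` such that
  off `F` the bilinear form is `≤ o‖x‖₂‖y‖₂` AND the Frobenius mass is `≤ K·o`.

With `o := min(ε²/(32L), cε²/(4K_G L))`, `L = ln(8/δ)`, this is exactly the matrix half of the leaf condition
(Hanson–Wright) of the paper's degree-2 simulation theorem `D_{ε,δ}(q) ≤ K₂ε⁻²ln(8/δ) + 3`; the other half is
one round of reading the large linear coefficients (F1 of file 28). Elementary; Mathlib + files 28/29.
-/

namespace Summit.QuantumAdvantage.QuantumAdvantage.Theorems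

namespace BoundedQuadratic

open Finset

variable {n : ℕ}

/-- **Row energies under a factorization.** If `|xᵀAy| ≤ K‖x‖_{L₂(w)}‖y‖_{L₂(w)}` for all `x, y` (`w ≥ 0`), then
for every row `i` and threshold `τ > 0`: `∑_{j : ¬(τ < w_j)} A_{ij}² ≤ K²·τ·wᵢ`. -/
theorem row_energy_of_factorization (A : Matrix (Fin n) (Fin n) ℝ) {K τ : ℝ} (hK : 0 ≤ K) (hτ : 0 < τ)
    (w : Fin n → ℝ) (hw : ∀ i, 0 ≤ w i)
    (hfac : ∀ x y : Fin n → ℝ, |∑ i, ∑ j, A i j * x i * y j| ≤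
      K * Real.sqrt (∑ i, w i * x i ^ 2) * Real.sqrt (∑ i, w i * y i ^ 2))
    (i : Fin n) :
    ∑ j, (if τ < w j then 0 else A i j ^ 2) ≤ K ^ 2 * τ * w i := by
  classical
  set R : ℝ := ∑ j, (if τ < w j then 0 else A i j ^ 2) with hR
  set x : Fin n → ℝ := fun a => if a = i then 1 else 0 with hx
  set y : Fin n → ℝ := fun b => if τ < w b then 0 else A i b with hy
  have hR0 : 0 ≤ R := sum_nonneg fun j _ => by
    by_cases h : τ < w j
    · simp [h]
    · simp [h, sq_nonneg]
  have hbil : ∑ a, ∑ b, A a b * x a * y b = R := by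
    rw [Finset.sum_eq_single i (fun a _ ha => by simp [hx, ha]) (fun h => absurd (mem_univ i) h)]
    refine sum_congr rfl fun b _ => ?_
    have hxi : x i = 1 := by simp [hx]
    rw [hxi]
    simp only [hy]
    split_ifs with h
    · ring
    · ring
  have hwx : ∑ a, w a * x a ^ 2 = w i := by
    rw [Finset.sum_eq_single i (fun a _ ha => by simp [hx, ha]) (fun h => absurd (mem_univ i) h)]
    simp [hx]
  have hwy : ∑ b, w b * y b ^ 2 ≤ τ * R := by
    rw [hR, mul_sum]
    refine sum_le_sum fun b _ => ?_
    simp only [hy]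
    split_ifs with h
    · simp
    · exact mul_le_mul_of_nonneg_right (not_lt.mp h) (sq_nonneg _)
  have h1 : R ≤ K * Real.sqrt (w i) * Real.sqrt (τ * R) := by
    have h := hfac x y
    rw [hbil, hwx] at h
    calc R ≤ |R| := le_abs_self R
      _ ≤ K * Real.sqrt (w i) * Real.sqrt (∑ b, w b * y b ^ 2) := h
      _ ≤ K * Real.sqrt (w i) * Real.sqrt (τ * R) := by
          apply mul_le_mul_of_nonneg_left (Real.sqrt_le_sqrt hwy)
          exact mul_nonneg hK (Real.sqrt_nonneg _)
  by_cases hRz : R = 0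
  · rw [hRz]
    exact mul_nonneg (mul_nonneg (sq_nonneg K) hτ.le) (hw i)
  · have hRpos : 0 < R := lt_of_le_of_ne hR0 (Ne.symm hRz)
    have h2 : R * R ≤ (K * Real.sqrt (w i) * Real.sqrt (τ * R)) *
        (K * Real.sqrt (w i) * Real.sqrt (τ * R)) := mul_self_le_mul_self hR0 h1
    have hsw : Real.sqrt (w i) * Real.sqrt (w i) = w i := Real.mul_self_sqrt (hw i)
    have hsτ : Real.sqrt (τ * R) * Real.sqrt (τ * R) = τ * R :=
      Real.mul_self_sqrt (mul_nonneg hτ.le hR0)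
    have h3 : R * R ≤ (K ^ 2 * τ * w i) * R := by
      calc R * R ≤ (K * Real.sqrt (w i) * Real.sqrt (τ * R)) *
            (K * Real.sqrt (w i) * Real.sqrt (τ * R)) := h2
        _ = K ^ 2 * (Real.sqrt (w i) * Real.sqrt (w i)) * (Real.sqrt (τ * R) * Real.sqrt (τ * R)) := by
            ring
        _ = (K ^ 2 * τ * w i) * R := by rw [hsw, hsτ]; ring
    exact le_of_mul_le_mul_right h3 hRpos

/-- **Frobenius norm under a factorization.** With `∑ wᵢ ≤ 1`: `∑_{i,j : wᵢ, w_j ≤ τ} A_{ij}² ≤ K²·τ` — the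
principal submatrix left after deleting `{i : wᵢ > τ}` has Frobenius norm squared at most `K²τ`. -/
theorem frobenius_of_factorization (A : Matrix (Fin n) (Fin n) ℝ) {K τ : ℝ} (hK : 0 ≤ K) (hτ : 0 < τ)
    (w : Fin n → ℝ) (hw : ∀ i, 0 ≤ w i) (hw1 : ∑ i, w i ≤ 1)
    (hfac : ∀ x y : Fin n → ℝ, |∑ i, ∑ j, A i j * x i * y j| ≤
      K * Real.sqrt (∑ i, w i * x i ^ 2) * Real.sqrt (∑ i, w i * y i ^ 2)) :
    ∑ i, ∑ j, (if τ < w i ∨ τ < w j then 0 else A i j ^ 2) ≤ K ^ 2 * τ := by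
  classical
  have hrow := row_energy_of_factorization A hK hτ w hw hfac
  calc ∑ i, ∑ j, (if τ < w i ∨ τ < w j then 0 else A i j ^ 2)
      ≤ ∑ i, ∑ j, (if τ < w j then 0 else A i j ^ 2) := by
        refine sum_le_sum fun i _ => sum_le_sum fun j _ => ?_
        by_cases h1 : τ < w i <;> by_cases h2 : τ < w j <;> simp [h1, h2, sq_nonneg]
    _ ≤ ∑ i, K ^ 2 * τ * w i := sum_le_sum fun i _ => hrow i
    _ = K ^ 2 * τ * ∑ i, w i := by rw [mul_sum]
    _ ≤ K ^ 2 * τ * 1 := mul_le_mul_of_nonneg_left hw1 (mul_nonneg (sq_nonneg K) hτ.le)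
    _ = K ^ 2 * τ := mul_one _

/-- **PHASE I of the paper's THEOREM E″ (`o`-form).** Under a factorization with constant `K > 0` and a
sub-probability weight, for every `o > 0` ONE set `F` with `|F| ≤ K/o` achieves simultaneously: the bilinear
form of the matrix off `F` is `≤ o‖x‖₂‖y‖₂` (all blocks have operator norm `≤ o`), and its Frobenius mass off
`F` is `≤ K·o`. (Take `F = {i : wᵢ > o/K}`.) -/
theorem grothendieck_phase (A : Matrix (Fin n) (Fin n) ℝ) {K : ℝ} (hK : 0 < K)
    (w : Fin n → ℝ) (hw : ∀ i, 0 ≤ w i) (hw1 : ∑ i, w i ≤ 1)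
    (hfac : ∀ x y : Fin n → ℝ, |∑ i, ∑ j, A i j * x i * y j| ≤
      K * Real.sqrt (∑ i, w i * x i ^ 2) * Real.sqrt (∑ i, w i * y i ^ 2))
    {o : ℝ} (ho : 0 < o) :
    ∃ F : Finset (Fin n), (F.card : ℝ) ≤ K / o ∧
      (∀ x y : Fin n → ℝ, (∀ i ∈ F, x i = 0) → (∀ i ∈ F, y i = 0) →
        |∑ i, ∑ j, A i j * x i * y j| ≤ o * Real.sqrt (∑ i, x i ^ 2) * Real.sqrt (∑ i, y i ^ 2)) ∧
      ∑ i, ∑ j, (if i ∈ F ∨ j ∈ F then 0 else A i j ^ 2) ≤ K * o := by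
  classical
  set τ : ℝ := o / K with hτdef
  have hτ : 0 < τ := div_pos ho hK
  have hKτ : K * τ = o := by rw [hτdef]; field_simp
  refine ⟨univ.filter fun i => τ < w i, ?_, ?_, ?_⟩
  · -- cardinality (Markov)
    have h1 : ((univ.filter fun i => τ < w i).card : ℝ) * τ
        = ∑ i ∈ univ.filter (fun i => τ < w i), τ := by
      rw [sum_const, nsmul_eq_mul]
    have h2 : ((univ.filter fun i => τ < w i).card : ℝ) * τ ≤ 1 := by
      rw [h1]
      calc ∑ i ∈ univ.filter (fun i => τ < w i), τ
          ≤ ∑ i ∈ univ.filter (fun i => τ < w i), w i :=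
            sum_le_sum fun i hi => le_of_lt (mem_filter.mp hi).2
        _ ≤ ∑ i, w i := sum_le_sum_of_subset_of_nonneg (filter_subset _ _) fun i _ _ => hw i
        _ ≤ 1 := hw1
    rw [le_div_iff₀ ho]
    calc ((univ.filter fun i => τ < w i).card : ℝ) * o
        = ((univ.filter fun i => τ < w i).card : ℝ) * τ * K := by rw [← hKτ]; ring
      _ ≤ 1 * K := mul_le_mul_of_nonneg_right h2 hK.le
      _ = K := one_mul K
  · -- operator-norm bound off F
    intro x y hx hy
    have mass : ∀ z : Fin n → ℝ, (∀ i ∈ univ.filter (fun i => τ < w i), z i = 0) →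
        ∑ i, w i * z i ^ 2 ≤ τ * ∑ i, z i ^ 2 := by
      intro z hz
      rw [mul_sum]
      refine sum_le_sum fun i _ => ?_
      by_cases hi : τ < w i
      · have : z i = 0 := hz i (mem_filter.mpr ⟨mem_univ _, hi⟩)
        simp [this]
      · exact mul_le_mul_of_nonneg_right (not_lt.mp hi) (sq_nonneg _)
    have root : ∀ z : Fin n → ℝ, (∀ i ∈ univ.filter (fun i => τ < w i), z i = 0) →
        Real.sqrt (∑ i, w i * z i ^ 2) ≤ Real.sqrt τ * Real.sqrt (∑ i, z i ^ 2) := by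
      intro z hz
      rw [← Real.sqrt_mul hτ.le]
      exact Real.sqrt_le_sqrt (mass z hz)
    have hx' := root x hx
    have hy' := root y hy
    have hτ2 : Real.sqrt τ * Real.sqrt τ = τ := Real.mul_self_sqrt hτ.le
    calc |∑ i, ∑ j, A i j * x i * y j|
        ≤ K * Real.sqrt (∑ i, w i * x i ^ 2) * Real.sqrt (∑ i, w i * y i ^ 2) := hfac x y
      _ ≤ K * (Real.sqrt τ * Real.sqrt (∑ i, x i ^ 2)) * Real.sqrt (∑ i, w i * y i ^ 2) := by
          apply mul_le_mul_of_nonneg_right _ (Real.sqrt_nonneg _)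
          exact mul_le_mul_of_nonneg_left hx' hK.le
      _ ≤ K * (Real.sqrt τ * Real.sqrt (∑ i, x i ^ 2)) * (Real.sqrt τ * Real.sqrt (∑ i, y i ^ 2)) := by
          apply mul_le_mul_of_nonneg_left hy'
          exact mul_nonneg hK.le (mul_nonneg (Real.sqrt_nonneg _) (Real.sqrt_nonneg _))
      _ = (K * τ) * ((Real.sqrt τ * Real.sqrt τ) / τ) * Real.sqrt (∑ i, x i ^ 2) * Real.sqrt (∑ i, y i ^ 2) := by
          field_simp
      _ = o * Real.sqrt (∑ i, x i ^ 2) * Real.sqrt (∑ i, y i ^ 2) := by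
          rw [hτ2, div_self hτ.ne', hKτ, mul_one]
  · -- Frobenius bound off F
    have hfro := frobenius_of_factorization A hK.le hτ w hw hw1 hfac
    have hKτ' : K ^ 2 * τ = K * o := by rw [← hKτ]; ring
    rw [← hKτ']
    refine le_trans (le_of_eq ?_) hfro
    refine sum_congr rfl fun i _ => sum_congr rfl fun j _ => ?_
    simp only [mem_filter, mem_univ, true_and]

end BoundedQuadratic

end Summit.QuantumAdvantage.QuantumAdvantage.Theorems
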